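import Literature.AnabelianGeometry.EtaleTheta.ThetaFamilyOfThetaTwistTower
import Literature.AnabelianGeometry.EtaleTheta.Discharge.Sec4CoprimePullThetaTwistTower
import Literature.AnabelianGeometry.EtaleTheta.Discharge.Sec4Prop42iiiThetaTwistTower
import Literature.AnabelianGeometry.EtaleTheta.BiKummerOfModelCanonical
import HarnessLib

/-!
# [EtTh] Def. 4.1 (i) / §5 p.330 at the FOURTH tower model: the theta function `Θ̈ ∈ O^×(A_⊙^birat)` as a BIRATIONAL UNIT over
# `A_⊙ = (Y_n, 0)` and its FRACTION-PAIR `(s′, s″)` — zero divisor = the cusps, divisor of poles = `D₁`, disjoint supports PROVED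

S. Mochizuki, *The étale theta function and its Frobenioid-theoretic manifestations*, Publ. RIMS **45** (2009) [MochizukiEtTh2009], Def. 3.6 (i)(ii)
pp.302–303 (PDF pp.76–77) (`B := B₀^Λ|_D ×_{(Φ^{ℝ-log})^gp} Φ^gp`, `Φ ⊆ Φ^{ℝ-log}`), Def. 4.1 (i) p.312 (PDF p.86) («a *fraction-pair* for `f` is
any base-equivalent pair of pre-steps `s′, s″ : A → B` such that `s′·(s″)⁻¹ = f ∈ O^×(A^birat)`, and, moreover, `Div(s′)`, `Div(s″)` have disjoint
supports»; zero divisor / divisor of poles p.313), Prop. 1.4 (i) p.247 (PDF p.21), §5 p.330 (PDF p.104) («the theta function determines an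
element of `O^×(A_⊙^birat)`»); [FrdI] = [MochizukiFrdI2008] Thm. 5.2 (i)(ii) pp.100–101 (model Frobenioid: objects `(A_D, α)`, morphisms
`(deg_Fr, Base, Div, u)` with `deg_Fr·α + Div = Base^*β + Div_B(u)`; `O^×(−)` on `C^birat` is `B`), Prop. 4.1 (iii) p.74.
[cite: MochizukiEtTh2009, Def 4.1 (i) p.86]  PAGE CONVENTION for [EtTh]: «printed N (PDF p.M)», N = M + 226.

CLASS (b) DATUM (definitions + theorems; abc-iut cell, layer L2, seat abc-iut-L2-d2 gen 8; abc-iut-L2-lead R1224 / plan/L2/SUBDAG-EtTh-JUNCTION.md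
slot D5 = (O6); FILE A2 of 2, over FILE A1 `ThetaFamilyOfThetaTwistTower`).  Consumed BY NAME, nothing restated: this seat's FILE 4
`ThetaTwistTowerTempered.temperedFrobenioid R S` (p493549: `Φ(A) = im(Φ₀(A)^pf → Φ₀(A)^rlf)`, `hpf`, `powDiagonalBase`, `hP`, `monoidType_eq`),
abc-iut-L2-t3's Def. 3.6 (i) weak data `ofRlfZWeak` (`divΛ = ι^gp ∘ div₀`, `isUnit_BΛ`), [FrdI] model-Frobenioid plumbing `ModelFrobenioid.mkHom` /
`zeroObj` (abc-iut-L1), abc-iut-L2-t9's model vocabulary `biratUnitsModel` / `fracOfModel` / `isUnit_ratFnFunctor` / `mkOfModelCanonical` and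
abc-iut-L6-t12's `coe_fracOfModel_mul_unit`, abc-iut-w6-d037's transfer `PowDiagonalBase.dvd_of_toRealification_dvd` (p496921), abc-iut-L2-t3's
`quotConnZeroObj` (p496301).  Pattern = abc-iut-w5-d134's `rootFractionPair_of` construction ([FrdI] Def. 1.3 (iii)(d): pre-steps with prescribed
zero divisor), here with a GENUINE function.
* §3 at the covering's own level `lvl Y_n = n`: `thetaB₀`, `thetaZerosΦ₀`, `thetaPolesΦ₀`, `div₀_thetaB₀`; the class map **`ιΦ : Φ₀(A) → Φ(A)`**
  (`subtype ∘ ι = (Φ₀ → Φ₀^ℝ)` pointwise `rfl`); the classes **`thetaZerosΦ`**, **`thetaPolesΦ`** `∈ Φ(Y_n)` with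
  **`coprime_thetaZerosΦ_thetaPolesΦ`** ([FrdI] Prop. 4.1 (iii) form: every common divisor is trivial); **`thetaDivB = ι^gp(div₀ θ)`** with
  `thetaDivB · [ι poles] = [ι zeros]`; **`thetaRatFn ∈ B(Y_n)`** = `(θ, Div_B Θ̈)` (membership = functoriality of `(−)^gp` along `Φ₀ → Φ ⊆ Φ₀^ℝ`).
* §4 **`Aodot = (Y_n, 0)`** (`= quotConnZeroObj isTemperedC (vOpenNormal n)` by `rfl`; Frobenius-trivial, Galois base), **`thetaUnit : O^×(A_⊙^birat)`**,
  the codomain **`thetaCod = (Y_n, [ι D₁])`**, the pre-steps **`thetaNum = (1, id, ι zeros, Θ̈)`**, **`thetaDen = (1, id, ι poles, 1)`** (relation (d)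
  of [FrdI] Thm. 5.2 (i) proved), base-equivalent, `fracOfModel thetaNum thetaDen = thetaUnit`, and **`thetaFractionPair`** — a
  `FractionPair (thetaUnit) (thetaCod)` of EVERY canonical §4 instance `mkOfModelCanonical X (temperedFrobenioid R S) …` (any Galois data / `(N,H)`-slot
  / anchor; in particular abc-iut-L2-t3's `mkOfQuotientTemperoid` and gen-7's socket) — the FIRST fraction-pair in the tree carrying a non-trivial
  function (all earlier inhabitants are `fractionPairOne` / toys); `zeroDivisor = thetaZerosΦ`, `poleDivisor = thetaPolesΦ`.
NEXT (FILE B, proof-only): `N`-th roots of `(Θ̈, s′, s″)` for every `N` from abc-iut-w6-d037's `prop42_iii_mkOfQuotientTemperoid_quotConnZeroObj`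
at `M := V_n`, and `hinvc` for every root datum.  HONEST FRAMING: class-(b) combinatorial DESIGN carrier (NOT the tempered Frobenioid of a Tate curve;
(β) sign deviation of record); the universe of `X` is that of the index category (`Type 1`; the Setting-universe twin over abc-iut-L2-t3's
`temperedFrobenioidSmall` is a `repr`-transport rider); junction hypotheses (`φ` onto — design-only per R1257, `hφ`-clauses of SUBDAG-JUNCTION) are
NOT touched here; no Prop-valued fact, no instance, no notation, no sorry; nothing here bears on [IUTchIII] Cor. 3.12; no side taken; typed ≠ proved.
-/

noncomputable section

namespace Literature.AnabelianGeometry.EtaleTheta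

open CategoryTheory Opposite Function Literature.AlgebraicGeometry.Frobenioids Literature.AlgebraicGeometry.Frobenioids.QuasiTemperoid
  Literature.AnabelianGeometry.SemiGraphs LogDivisorModel LogDivisorModel.GaloisAction LogDivisorTower

namespace ThetaTwistTowerTempered

open LogDivisorModel.TateTowerThetaTwist TateTowerKummerTwistRShear
open TateTowerKummerTwist (N coe_N N_dvd_M eN eN_pos)

/-! ## §3 At the covering's own level: the classes of the two divisors in `Φ(Y_n)` and the theta function in `B(Y_n)` -/

variable (R S : ((ConnectedPart (BTemp (Compat 3 thetaShear)))ᵒᵖ ⥤ CommMonCat.{0}) → Prop) (n : ℕ)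

/-- `ι : Φ₀(A) → Φ(A) = im(Φ₀(A)^pf → Φ₀(A)^rlf)`, the class map of the fourth model at a covering `A`. [cite: MochizukiEtTh2009, Def 3.6 p.77] -/
def ιΦ (A : ConnectedPart (BTemp (Compat 3 thetaShear))) :
    dm.Φ₀.obj (op A) →* (ThetaTwistTowerTempered.temperedFrobenioid R S).divisorMonoid.obj (op A) :=
  (hpf (op A)).weak.toRealification.mrangeRestrict.comp (Perfection.of _)

/-- `ι` on elements. [cite: MochizukiEtTh2009, Def 3.6 p.77] -/
theorem coe_ιΦ (A : ConnectedPart (BTemp (Compat 3 thetaShear))) (ψ : dm.Φ₀.obj (op A)) :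
    (ιΦ R S A ψ).1 = (hpf (op A)).weak.toRealification (Perfection.of _ ψ) := rfl

/-- **`θ` in `B₀(Y_n)` of the Def. 3.3 (iii) data of the fourth model** (the covering read at its OWN level `lvl Y_n = n`).
[cite: MochizukiEtTh2009, Def 3.3 (iii) p.73] -/
def thetaB₀ : dm.B₀.obj (op (YV n)) := thetaFam n (lvlC 3 thetaShear (YV n)) (lvlC_YV n).le

/-- The zero divisor family in `Φ₀(Y_n)` of the data. [cite: MochizukiEtTh2009, Def 3.3 (iii) p.73] -/
def thetaZerosΦ₀ : dm.Φ₀.obj (op (YV n)) := thetaZerosFam n (lvlC 3 thetaShear (YV n))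

/-- The polar divisor family in `Φ₀(Y_n)` of the data. [cite: MochizukiEtTh2009, Def 3.3 (iii) p.73] -/
def thetaPolesΦ₀ : dm.Φ₀.obj (op (YV n)) := thetaPolesFam n (lvlC 3 thetaShear (YV n))

/-- `div₀ θ = [zeros]/[poles]` in the data's `Φ₀(Y_n)^gp`. [cite: MochizukiEtTh2009, Def 3.3 (iii) p.73] -/
theorem div₀_thetaB₀ : dm.div₀ (op (YV n)) (thetaB₀ n) =
    Algebra.GrothendieckGroup.of (thetaZerosΦ₀ n) / Algebra.GrothendieckGroup.of (thetaPolesΦ₀ n) :=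
  divZeroHom_thetaFam n _ (lvlC_YV n).le

/-- Product form: `div₀ θ · [poles] = [zeros]`. [cite: MochizukiEtTh2009, Def 3.3 (iii) p.73] -/
theorem div₀_thetaB₀_mul : dm.div₀ (op (YV n)) (thetaB₀ n) * Algebra.GrothendieckGroup.of (thetaPolesΦ₀ n) =
    Algebra.GrothendieckGroup.of (thetaZerosΦ₀ n) :=
  eq_div_iff_mul_eq'.mp (div₀_thetaB₀ n)

/-- The classes of the two families in `Φ₀(Y_n)^pf` are coprime. [cite: MochizukiEtTh2009, Def 4.1 (i) p.86] -/
theorem perfection_coprime_thetaZerosΦ₀ (ξ : Perfection (dm.Φ₀.obj (op (YV n)))) (hz : ξ ∣ Perfection.of _ (thetaZerosΦ₀ n))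
    (hp : ξ ∣ Perfection.of _ (thetaPolesΦ₀ n)) : ξ = 1 :=
  perfection_coprime_thetaZerosFam n _ ξ hz hp

/-- **The class of the ZERO divisor of the theta function in `Φ(Y_n)`** (FILE 4's witness of `Φ^{bs-fld} ⊊ Φ`, `thetaZeros_mem_Φ`).
[cite: MochizukiEtTh2009, Def 4.1 (i) p.87] -/
def thetaZerosΦ : (ThetaTwistTowerTempered.temperedFrobenioid R S).divisorMonoid.obj (op (YV n)) := ιΦ R S (YV n) (thetaZerosΦ₀ n)

/-- **The class of the POLAR divisor of the theta function in `Φ(Y_n)`.** [cite: MochizukiEtTh2009, Def 4.1 (i) p.87] -/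
def thetaPolesΦ : (ThetaTwistTowerTempered.temperedFrobenioid R S).divisorMonoid.obj (op (YV n)) := ιΦ R S (YV n) (thetaPolesΦ₀ n)

/-- **`Div(s′)`, `Div(s″)` have disjoint supports** in the [FrdI] Prop. 4.1 (iii) coprimality form of the canonical §4 instance: every
common divisor in `Φ(Y_n)` of the two classes is trivial (transfer to `Φ₀^pf` by abc-iut-w6-d037's `dvd_of_toRealification_dvd`, there
`perfection_coprime_thetaZerosFam`). [cite: MochizukiEtTh2009, Def 4.1 (i) p.86] -/
theorem coprime_thetaZerosΦ_thetaPolesΦ (x : (ThetaTwistTowerTempered.temperedFrobenioid R S).divisorMonoid.obj (op (YV n)))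
    (hz : x ∣ thetaZerosΦ R S n) (hp : x ∣ thetaPolesΦ R S n) : x = 1 := by
  obtain ⟨ξ, hξ⟩ := x.2
  have hz' := TemperedFrobenioid.PowDiagonalBase.dvd_of_toRealification_dvd hpf powDiagonalBase _ _ _ R S (op (YV n)) ξ
    (Perfection.of _ (thetaZerosΦ₀ n)) x (thetaZerosΦ R S n) hξ rfl hz
  have hp' := TemperedFrobenioid.PowDiagonalBase.dvd_of_toRealification_dvd hpf powDiagonalBase _ _ _ R S (op (YV n)) ξ
    (Perfection.of _ (thetaPolesΦ₀ n)) x (thetaPolesΦ R S n) hξ rfl hp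
  have h1 : ξ = 1 := perfection_coprime_thetaZerosΦ₀ n ξ hz' hp'
  apply Subtype.ext
  rw [← hξ, h1]
  exact map_one _

/-- `ι` IS the Def. 3.6 (i) map `Φ₀ → Φ₀^ℝ` of the weak data followed by the inclusion `Φ(A) ⊆ Φ₀^ℝ(A)` (pointwise definitional).
[cite: MochizukiEtTh2009, Def 3.6 p.76] -/
theorem subtype_comp_ιΦ (A : ConnectedPart (BTemp (Compat 3 thetaShear))) :
    ((ThetaTwistTowerTempered.temperedFrobenioid R S).Φ.carrier (op A)).subtype.comp (ιΦ R S A) =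
      ((toRlfNatTransWeak dm.Φ₀ hpf).app (op A)).hom :=
  MonoidHom.ext fun _ => rfl

/-- **`Div_B(Θ̈) ∈ Φ(Y_n)^gp`**: the image of `div₀ θ` under `ι^gp`. [cite: MochizukiEtTh2009, Def 4.1 (i) p.87] -/
def thetaDivB : Algebra.GrothendieckGroup ((ThetaTwistTowerTempered.temperedFrobenioid R S).divisorMonoid.obj (op (YV n))) :=
  EtaleTheta.gpMap (ιΦ R S (YV n)) (dm.div₀ (op (YV n)) (thetaB₀ n))

/-- **`Div_B(Θ̈) · [ι poles] = [ι zeros]` in `Φ(Y_n)^gp`** — the zero divisor and the divisor of poles of the theta function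
([FrdI] Thm. 5.2 (ii): `Div_B(s′·(s″)⁻¹) = Div(s′) − Div(s″)`). [cite: MochizukiEtTh2009, Def 4.1 (i) p.87] -/
theorem thetaDivB_mul_of_thetaPolesΦ :
    thetaDivB R S n * Algebra.GrothendieckGroup.of (thetaPolesΦ R S n) = Algebra.GrothendieckGroup.of (thetaZerosΦ R S n) := by
  have e1 : EtaleTheta.gpMap (ιΦ R S (YV n)) (Algebra.GrothendieckGroup.of (thetaPolesΦ₀ n)) =
      Algebra.GrothendieckGroup.of (thetaPolesΦ R S n) := EtaleTheta.gpMap_of _ _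
  have e2 : EtaleTheta.gpMap (ιΦ R S (YV n)) (Algebra.GrothendieckGroup.of (thetaZerosΦ₀ n)) =
      Algebra.GrothendieckGroup.of (thetaZerosΦ R S n) := EtaleTheta.gpMap_of _ _
  have e3 := (EtaleTheta.gpMap (ιΦ R S (YV n))).map_mul (dm.div₀ (op (YV n)) (thetaB₀ n)) (Algebra.GrothendieckGroup.of (thetaPolesΦ₀ n))
  exact (congrArg (thetaDivB R S n * ·) e1.symm).trans
    (e3.symm.trans ((congrArg (EtaleTheta.gpMap (ιΦ R S (YV n))) (div₀_thetaB₀_mul n)).trans e2))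

/-- Quotient form: `Div_B(Θ̈) = [ι zeros] / [ι poles]`. [cite: MochizukiEtTh2009, Def 4.1 (i) p.87] -/
theorem thetaDivB_eq_div :
    thetaDivB R S n = Algebra.GrothendieckGroup.of (thetaZerosΦ R S n) / Algebra.GrothendieckGroup.of (thetaPolesΦ R S n) :=
  eq_div_iff_mul_eq'.mpr (thetaDivB_mul_of_thetaPolesΦ R S n)

/-- The pair (`θ` at the covering's own level, `Div_B(Θ̈)`) lies in `B(Y_n) = B₀(Y_n) ×_{(Φ^rlf)^gp} Φ(Y_n)^gp`: both components have the
same image in `(Φ₀^rlf)^gp` (functoriality of `(−)^gp` along `Φ₀ → Φ ⊆ Φ₀^ℝ`). [cite: MochizukiEtTh2009, Def 3.6 p.77] -/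
theorem thetaRatFn_mem :
    ((thetaB₀ n, thetaDivB R S n) :
        ((RealifiedDivisorMonoids.ofRlfZWeak dm hpf).BΛ.obj ((ThetaTwistTowerTempered.temperedFrobenioid R S).baseOp (op (YV n))) : Type) ×
          Algebra.GrothendieckGroup ((ThetaTwistTowerTempered.temperedFrobenioid R S).Φ.carrier (op (YV n)))) ∈
      (ThetaTwistTowerTempered.temperedFrobenioid R S).ratFn (op (YV n)) := by
  change EtaleTheta.gpMap ((toRlfNatTransWeak dm.Φ₀ hpf).app (op (YV n))).hom (dm.div₀ (op (YV n)) (thetaB₀ n)) =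
    EtaleTheta.gpMap ((ThetaTwistTowerTempered.temperedFrobenioid R S).Φ.carrier (op (YV n))).subtype
      (EtaleTheta.gpMap (ιΦ R S (YV n)) (dm.div₀ (op (YV n)) (thetaB₀ n)))
  exact ((congrArg (fun F => EtaleTheta.gpMap F (dm.div₀ (op (YV n)) (thetaB₀ n))) (subtype_comp_ιΦ R S (YV n))).symm.trans
    (gpMap_comp_apply'' _ _ _))

/-- **`Θ̈ ∈ B(Y_n)`** — the theta function as a rational function of the fourth model at the covering `Y_n`. [cite: MochizukiEtTh2009, §5 p.330] -/
def thetaRatFn : (ThetaTwistTowerTempered.temperedFrobenioid R S).ratFnFunctor.obj (op (YV n)) := ⟨_, thetaRatFn_mem R S n⟩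

/-- Its function component is `θ` (definitionally). [cite: MochizukiEtTh2009, Def 3.6 p.77] -/
theorem thetaRatFn_fst : (thetaRatFn R S n).1.1 = thetaB₀ n := rfl

/-- `Div_B` of the rational function `Θ̈` is `Div_B(Θ̈)` (definitionally). [cite: MochizukiEtTh2009, Def 4.1 (i) p.87] -/
theorem divB_thetaRatFn :
    Literature.AlgebraicGeometry.Frobenioids.divB (ThetaTwistTowerTempered.temperedFrobenioid R S).divisorMonoid
        (ThetaTwistTowerTempered.temperedFrobenioid R S).ratFnFunctor (ThetaTwistTowerTempered.temperedFrobenioid R S).divBNatTrans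
        (op (YV n)) (thetaRatFn R S n) = thetaDivB R S n := rfl

/-- **`Div_B(Θ̈) = [ι zeros] − [ι poles]` in `Φ(Y_n)^gp`.** [cite: MochizukiEtTh2009, Def 4.1 (i) p.87] -/
theorem divB_thetaRatFn_eq_div :
    Literature.AlgebraicGeometry.Frobenioids.divB (ThetaTwistTowerTempered.temperedFrobenioid R S).divisorMonoid
        (ThetaTwistTowerTempered.temperedFrobenioid R S).ratFnFunctor (ThetaTwistTowerTempered.temperedFrobenioid R S).divBNatTrans
        (op (YV n)) (thetaRatFn R S n) =
      Algebra.GrothendieckGroup.of (thetaZerosΦ R S n) / Algebra.GrothendieckGroup.of (thetaPolesΦ R S n) :=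
  thetaDivB_eq_div R S n

/-! ## §4 The object `A_⊙ := (Y_n, 0)`, the birational unit `Θ̈ ∈ O^×(A_⊙^birat)` and its FRACTION-PAIR -/

/-- **`A_⊙ := (Y_n, 0)`** — the Frobenius-trivial object of the fourth model over `Y_n` ([FrdI] Thm. 5.2 (i) `ModelFrobenioid.zeroObj`;
it IS abc-iut-L2-t3's `quotConnZeroObj` at `M := V_n`, the anchor of abc-iut-w6-d037's `prop42_iii_mkOfQuotientTemperoid_quotConnZeroObj`,
see `Aodot_eq`). [cite: MochizukiEtTh2009, Def 4.1 p.86] -/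
abbrev Aodot : (ThetaTwistTowerTempered.temperedFrobenioid R S).category :=
  ModelFrobenioid.zeroObj (ThetaTwistTowerTempered.temperedFrobenioid R S).divisorMonoid
    (ThetaTwistTowerTempered.temperedFrobenioid R S).ratFnFunctor (ThetaTwistTowerTempered.temperedFrobenioid R S).divBNatTrans (YV n)

/-- `A_⊙ = (Compat₃′/V_n, 0)` of abc-iut-L2-t3 (definitionally). [cite: MochizukiEtTh2009, Def 4.1 p.86] -/
theorem Aodot_eq : Aodot R S n =
    (ThetaTwistTowerTempered.temperedFrobenioid R S).quotConnZeroObj (isTemperedC 3 thetaShear) (vOpenNormal 3 thetaShear n) := rfl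

/-- `A_⊙^bs = Y_n` (definitionally). [cite: MochizukiEtTh2009, Def 4.1 p.86] -/
theorem Aodot_base : (Aodot R S n).base = YV n := rfl

/-- The class of `A_⊙` is trivial (definitionally). [cite: MochizukiFrdI2008, Thm. 5.2 p.101] -/
theorem Aodot_cls : (Aodot R S n).cls = 1 := rfl

/-- `A_⊙` is Frobenius-trivial ([FrdI] Thm. 5.2 (i)). [cite: MochizukiFrdI2008, Thm. 5.2 p.101] -/
theorem isFrobeniusTrivial_Aodot :
    PreFrobenioid.IsFrobeniusTrivial (ThetaTwistTowerTempered.temperedFrobenioid R S).toElem (Aodot R S n) :=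
  (ThetaTwistTowerTempered.temperedFrobenioid R S).isFrobeniusTrivial_quotConnZeroObj (isTemperedC 3 thetaShear)
    (vOpenNormal 3 thetaShear n)

/-- `A_⊙^bs` is a Galois object ([SemiAnbd] Rmk. 3.1.3: `V_n` is open NORMAL). [cite: MochizukiSemiAnbd2006, Rmk 3.1.3 p.34] -/
theorem isGaloisObj_Aodot_base : IsGaloisObj (Aodot R S n).base.obj :=
  (ThetaTwistTowerTempered.temperedFrobenioid R S).isGaloisObj_quotConnZeroObj_base (isTemperedC 3 thetaShear)
    (vOpenNormal 3 thetaShear n)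

/-- **`Θ̈ ∈ O^×(A_⊙^birat) = B(Y_n)^×`** — «the theta function determines an element of `O^×(A_⊙^birat)`» (§5 p.330; `B` is group-like,
[FrdI] Thm. 5.2 (ii)). [cite: MochizukiEtTh2009, §5 p.330] -/
def thetaUnit : (ThetaTwistTowerTempered.temperedFrobenioid R S).biratUnitsModel (Aodot R S n) :=
  ((ThetaTwistTowerTempered.temperedFrobenioid R S).isUnit_ratFnFunctor (RealifiedDivisorMonoids.ofRlfZWeak dm hpf).isUnit_BΛ
    (Aodot R S n) (thetaRatFn R S n)).unit

/-- The underlying element of `B(Y_n)` of the unit is `Θ̈`. [cite: MochizukiEtTh2009, §5 p.330] -/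
theorem coe_thetaUnit :
    ((thetaUnit R S n : (ThetaTwistTowerTempered.temperedFrobenioid R S).biratUnitsModel (Aodot R S n)) :
        (ThetaTwistTowerTempered.temperedFrobenioid R S).ratFnFunctor.obj (op (Aodot R S n).base)) = thetaRatFn R S n :=
  IsUnit.unit_spec _

/-- **The codomain `B := (Y_n, [ι D₁])`** of the fraction-pair of `Θ̈` ([FrdI] Thm. 5.2 (i): the class of the object is the polar divisor).
[cite: MochizukiEtTh2009, Def 4.1 (i) p.86] -/
abbrev thetaCod : (ThetaTwistTowerTempered.temperedFrobenioid R S).category :=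
  ⟨YV n, Algebra.GrothendieckGroup.of (thetaPolesΦ R S n)⟩

/-- The class of the codomain is `[ι D₁]` (definitionally). [cite: MochizukiFrdI2008, Thm. 5.2 p.100] -/
theorem thetaCod_cls : (thetaCod R S n).cls = Algebra.GrothendieckGroup.of (thetaPolesΦ R S n) := rfl

/-- Relation (d) of [FrdI] Thm. 5.2 (i) for the numerator: `0 + [ι zeros] = [ι poles] + Div_B Θ̈`. [cite: MochizukiFrdI2008, Thm. 5.2 p.100] -/
theorem rel_thetaNum :
    (1 : Algebra.GrothendieckGroup ((ThetaTwistTowerTempered.temperedFrobenioid R S).divisorMonoid.obj (op (YV n)))) ^ ((1 : ℕ+) : ℕ) *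
        Algebra.GrothendieckGroup.of (thetaZerosΦ R S n) =
    pullGp (ThetaTwistTowerTempered.temperedFrobenioid R S).divisorMonoid (𝟙 (YV n))
        (Algebra.GrothendieckGroup.of (thetaPolesΦ R S n)) *
      Literature.AlgebraicGeometry.Frobenioids.divB (ThetaTwistTowerTempered.temperedFrobenioid R S).divisorMonoid
        (ThetaTwistTowerTempered.temperedFrobenioid R S).ratFnFunctor (ThetaTwistTowerTempered.temperedFrobenioid R S).divBNatTrans
        (op (YV n)) (thetaRatFn R S n) := by
  rw [one_pow, one_mul, pullGp_id, divB_thetaRatFn, mul_comm]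
  exact (thetaDivB_mul_of_thetaPolesΦ R S n).symm

/-- Relation (d) of [FrdI] Thm. 5.2 (i) for the denominator: `0 + [ι poles] = [ι poles] + 0`. [cite: MochizukiFrdI2008, Thm. 5.2 p.100] -/
theorem rel_thetaDen :
    (1 : Algebra.GrothendieckGroup ((ThetaTwistTowerTempered.temperedFrobenioid R S).divisorMonoid.obj (op (YV n)))) ^ ((1 : ℕ+) : ℕ) *
        Algebra.GrothendieckGroup.of (thetaPolesΦ R S n) =
    pullGp (ThetaTwistTowerTempered.temperedFrobenioid R S).divisorMonoid (𝟙 (YV n))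
        (Algebra.GrothendieckGroup.of (thetaPolesΦ R S n)) *
      Literature.AlgebraicGeometry.Frobenioids.divB (ThetaTwistTowerTempered.temperedFrobenioid R S).divisorMonoid
        (ThetaTwistTowerTempered.temperedFrobenioid R S).ratFnFunctor (ThetaTwistTowerTempered.temperedFrobenioid R S).divBNatTrans
        (op (YV n)) 1 := by
  rw [one_pow, one_mul, pullGp_id, map_one, mul_one]

/-- **The numerator pre-step `s′ := (1, id, ι zeros, Θ̈) : A_⊙ → B`** ([FrdI] Thm. 5.2 (i)). [cite: MochizukiEtTh2009, Def 4.1 (i) p.86] -/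
def thetaNum : Aodot R S n ⟶ thetaCod R S n :=
  ModelFrobenioid.mkHom (Aodot R S n) (thetaCod R S n) 1 (𝟙 (YV n)) (thetaZerosΦ R S n) (thetaRatFn R S n) (rel_thetaNum R S n)

/-- **The denominator pre-step `s″ := (1, id, ι poles, 1) : A_⊙ → B`.** [cite: MochizukiEtTh2009, Def 4.1 (i) p.86] -/
def thetaDen : Aodot R S n ⟶ thetaCod R S n :=
  ModelFrobenioid.mkHom (Aodot R S n) (thetaCod R S n) 1 (𝟙 (YV n)) (thetaPolesΦ R S n) 1 (rel_thetaDen R S n)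

/-- `Div(s′) = ι(zeros)`. [cite: MochizukiEtTh2009, Def 4.1 (i) p.87] -/
@[simp] theorem div_thetaNum : ModelFrobenioid.div (thetaNum R S n) = thetaZerosΦ R S n := ModelFrobenioid.div_mkHom _ _ _ _ _

/-- `Div(s″) = ι(poles)`. [cite: MochizukiEtTh2009, Def 4.1 (i) p.87] -/
@[simp] theorem div_thetaDen : ModelFrobenioid.div (thetaDen R S n) = thetaPolesΦ R S n := ModelFrobenioid.div_mkHom _ _ _ _ _

/-- `u_{s′} = Θ̈`. [cite: MochizukiEtTh2009, Def 4.1 (i) p.86] -/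
@[simp] theorem unit_thetaNum : ModelFrobenioid.unit (thetaNum R S n) = thetaRatFn R S n := ModelFrobenioid.unit_mkHom _ _ _ _ _

/-- `u_{s″} = 1`. [cite: MochizukiEtTh2009, Def 4.1 (i) p.86] -/
@[simp] theorem unit_thetaDen : ModelFrobenioid.unit (thetaDen R S n) = 1 := ModelFrobenioid.unit_mkHom _ _ _ _ _

/-- `Base(s′) = id`. [cite: MochizukiEtTh2009, Def 4.1 (i) p.86] -/
@[simp] theorem baseMap_thetaNum : ModelFrobenioid.baseMap (thetaNum R S n) = 𝟙 (YV n) := ModelFrobenioid.baseMap_mkHom _ _ _ _ _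

/-- `Base(s″) = id`. [cite: MochizukiEtTh2009, Def 4.1 (i) p.86] -/
@[simp] theorem baseMap_thetaDen : ModelFrobenioid.baseMap (thetaDen R S n) = 𝟙 (YV n) := ModelFrobenioid.baseMap_mkHom _ _ _ _ _

/-- `deg_Fr(s′) = 1`. [cite: MochizukiEtTh2009, Def 4.1 (i) p.86] -/
@[simp] theorem degFr_thetaNum : ModelFrobenioid.degFr (thetaNum R S n) = 1 := ModelFrobenioid.degFr_mkHom _ _ _ _ _

/-- `deg_Fr(s″) = 1`. [cite: MochizukiEtTh2009, Def 4.1 (i) p.86] -/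
@[simp] theorem degFr_thetaDen : ModelFrobenioid.degFr (thetaDen R S n) = 1 := ModelFrobenioid.degFr_mkHom _ _ _ _ _

/-- `s′` is a pre-step (Frobenius degree `1`, base an isomorphism). [cite: MochizukiEtTh2009, Def 4.1 (i) p.86] -/
theorem isPreStep_thetaNum : PreFrobenioid.IsPreStep (ThetaTwistTowerTempered.temperedFrobenioid R S).toElem (thetaNum R S n) :=
  ⟨degFr_thetaNum R S n, by show IsIso (ModelFrobenioid.baseMap (thetaNum R S n)); rw [baseMap_thetaNum]; exact IsIso.id _⟩

/-- `s″` is a pre-step. [cite: MochizukiEtTh2009, Def 4.1 (i) p.86] -/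
theorem isPreStep_thetaDen : PreFrobenioid.IsPreStep (ThetaTwistTowerTempered.temperedFrobenioid R S).toElem (thetaDen R S n) :=
  ⟨degFr_thetaDen R S n, by show IsIso (ModelFrobenioid.baseMap (thetaDen R S n)); rw [baseMap_thetaDen]; exact IsIso.id _⟩

/-- `s′`, `s″` are base-equivalent (both over `id_{Y_n}`). [cite: MochizukiEtTh2009, Def 4.1 (i) p.86] -/
theorem baseEquivalent_thetaNum_thetaDen :
    PreFrobenioid.BaseEquivalent (ThetaTwistTowerTempered.temperedFrobenioid R S).toElem (thetaNum R S n) (thetaDen R S n) := by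
  change ModelFrobenioid.baseMap (thetaNum R S n) = ModelFrobenioid.baseMap (thetaDen R S n)
  rw [baseMap_thetaNum, baseMap_thetaDen]

/-- **`s′ · (s″)⁻¹ = Θ̈` in `O^×(A_⊙^birat)`** (the model's fraction `u_{s′} · u_{s″}⁻¹ = Θ̈ · 1⁻¹`). [cite: MochizukiEtTh2009, Def 4.1 (i) p.86] -/
theorem fracOfModel_thetaNum_thetaDen :
    (ThetaTwistTowerTempered.temperedFrobenioid R S).fracOfModel (RealifiedDivisorMonoids.ofRlfZWeak dm hpf).isUnit_BΛ
        (thetaNum R S n) (thetaDen R S n) = thetaUnit R S n := by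
  apply Units.ext
  have h := BiKummerSetting.coe_fracOfModel_mul_unit (ThetaTwistTowerTempered.temperedFrobenioid R S)
    (RealifiedDivisorMonoids.ofRlfZWeak dm hpf).isUnit_BΛ (thetaNum R S n) (thetaDen R S n)
  rw [unit_thetaDen, mul_one, unit_thetaNum] at h
  rw [h, coe_thetaUnit]

variable {K : Type 1} [Field K] (X : SemiGraphs.TemperedArithmeticGroup.{1} K) (IG : ConnectedPart (BTemp (Compat 3 thetaShear)) → Prop)
  (gS : ∀ A : ConnectedPart (BTemp (Compat 3 thetaShear)), IG A → (X.Pi →* Aut A))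
  (gSs : ∀ (A : ConnectedPart (BTemp (Compat 3 thetaShear))) (h : IG A), Function.Surjective (gS A h))
  (NH : Subgroup (Field.absoluteGaloisGroup K) → (ThetaTwistTowerTempered.temperedFrobenioid R S).category → ℕ+ → Prop)
  (A₀ : (ThetaTwistTowerTempered.temperedFrobenioid R S).category)
  (hA₀ : PreFrobenioid.IsFrobeniusTrivial (ThetaTwistTowerTempered.temperedFrobenioid R S).toElem A₀) (hA₀' : IG A₀.base)

/-- **THE FRACTION-PAIR OF THE THETA FUNCTION** (Def. 4.1 (i)) at the fourth tower model, in EVERY canonical §4 instance over it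
(abc-iut-L2-t9's `mkOfModelCanonical`: any Galois data `IG`/`gS`, any `(N,H)`-slot, any anchor — in particular abc-iut-L2-t3's
`mkOfQuotientTemperoid` and gen-7's free-Galois socket): domain `A_⊙ = (Y_n, 0)`, codomain `(Y_n, [ι D₁])`, `s′ = (1, id, ι zeros, Θ̈)`,
`s″ = (1, id, ι poles, 1)`, zero divisor = the cusps, divisor of poles = `D₁`, disjoint supports PROVED — the first fraction-pair in the tree
carrying a non-trivial function. [cite: MochizukiEtTh2009, Def 4.1 (i) p.86] -/
def thetaFractionPair :
    (BiKummerSetting.mkOfModelCanonical X (ThetaTwistTowerTempered.temperedFrobenioid R S) (monoidType_eq R S) (hP R S) IG gS gSs NH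
        A₀ hA₀ hA₀').FractionPair (A := Aodot R S n) (thetaUnit R S n) (thetaCod R S n) where
  num := thetaNum R S n
  den := thetaDen R S n
  isPreStep_num := isPreStep_thetaNum R S n
  isPreStep_den := isPreStep_thetaDen R S n
  base_eq := baseEquivalent_thetaNum_thetaDen R S n
  frac_eq := fracOfModel_thetaNum_thetaDen R S n
  disjointSupports := fun x hx hx' => coprime_thetaZerosΦ_thetaPolesΦ R S n x hx hx'

/-- Its numerator is `s′`. [cite: MochizukiEtTh2009, Def 4.1 (i) p.86] -/
@[simp] theorem thetaFractionPair_num : (thetaFractionPair R S n X IG gS gSs NH A₀ hA₀ hA₀').num = thetaNum R S n := rfl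

/-- Its denominator is `s″`. [cite: MochizukiEtTh2009, Def 4.1 (i) p.86] -/
@[simp] theorem thetaFractionPair_den : (thetaFractionPair R S n X IG gS gSs NH A₀ hA₀ hA₀').den = thetaDen R S n := rfl

/-- Its zero divisor is the class of the cusps. [cite: MochizukiEtTh2009, Def 4.1 (i) p.87] -/
theorem thetaFractionPair_zeroDivisor : (thetaFractionPair R S n X IG gS gSs NH A₀ hA₀ hA₀').zeroDivisor = thetaZerosΦ R S n :=
  div_thetaNum R S n

/-- Its divisor of poles is the class of `D₁`. [cite: MochizukiEtTh2009, Def 4.1 (i) p.87] -/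
theorem thetaFractionPair_poleDivisor : (thetaFractionPair R S n X IG gS gSs NH A₀ hA₀ hA₀').poleDivisor = thetaPolesΦ R S n :=
  div_thetaDen R S n

end ThetaTwistTowerTempered

end Literature.AnabelianGeometry.EtaleTheta

end
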